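import Literature.Probability.LatticeModels.ScaleFrameRatioPaths
import Literature.Probability.LatticeModels.RandomClusterArmConditioningOff
import Literature.Probability.LatticeModels.ScaleFrameDatumDecomp
import HarnessLib

/-!
# Kesten's ratio forgetting along a scale frame: the junk of one level of the chain (proved)

Topic `Literature/Probability/LatticeModels` (trunk `StatMech`, family `crit-ising`). In the
one-level chain identity of Kesten's ratio-limit scheme (H. Kesten, PTRF 73 (1986), proof of
Thm. 3, eqs. (16)–(19); planarity-free form of D. Basu, A. Sapozhnikov, ECP 22 (2017), §2) run on a
`ScaleFrame`, the configurations whose inner rim is NOT wired off the inside form the "junk". On the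
block `(b, bM^m)` explored from `inSet b` this junk is small relative to any increasing event `A`
and any context event `Fo` read on the far edges (`ScaleFrame.inter_notWiredOff_le`):

  `φ(A ∩ Fo ∩ {rim not wired off inSet b}) ≤ (1 - c)^{⌊m/2⌋} · φ(A ∩ Fo)`,

`φ` the free random-cluster measure of the frame graph, `c` the separator constant of the frame's
RSW hypothesis `SepBound` for the sub-annuli `(bM^i, bM^{i+1})`, `i + 1 ≤ m`. Proof: by
`ScaleFrame.rimWiredOff_of_sepEvent` the junk configurations have no open separator in any
sub-annulus, in particular in none of the `⌊m/2⌋` ODD ones, whose touching edge sets are pairwise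
disjoint (frame continuity); the separator of the `i`-th sub-annulus has conditional probability
`≥ c` given everything off its edges (`SepBound` pushed through the conditional domination
`rcMeasure_real_inter_cylinder_le_mul_fromEdgeSet_of_isLowerSet`), so the successive-conditioning
brick `rcMeasure_real_inter_inter_biInter_compl_le` applies. Everything is proved; no definitions.

## References
* [Kesten1986] H. Kesten, Probab. Theory Related Fields 73 (1986) 369–394, proof of Thm. 3.
* [BasuSapozhnikov2017ECP] D. Basu, A. Sapozhnikov, ECP 22 (2017) no. 26, §2.
* G. Grimmett, *The Random-Cluster Model*, Springer (2006), Thm. (3.8)(b), Lemma (4.13).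
-/

open MeasureTheory Finset SimpleGraph
open Literature.Probability.Percolation (BondConfig openConnIn explSet explRim explEvent)

namespace Literature.Probability.LatticeModels

variable {V : Type*} [Fintype V] [DecidableEq V]

/-- **The separator bound, conditionally on everything off the annulus.** Under `SepBound p q c s s'`
the event "the trace on the genuine frame edges `U` touching `annSet s s'` has an open separator"
has conditional probability `≥ c` given any cylinder `{ω ∖ U = ξ}` of the free measure of a graph
equal to the frame graph: the complement is decreasing, so conditional domination bounds it by its
free local probability `≤ 1 - c`. [cite: Kesten1986, §2 eq. (28)] -/
theorem ScaleFrame.sepBound_cylinder (F : ScaleFrame V) (G : SimpleGraph V) [DecidableRel G.Adj]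
    (hG : G = fromEdgeSet (↑F.E : Set (Sym2 V))) {p q c s s' : ℝ} (hp : p ∈ Set.Icc (0 : ℝ) 1)
    (hq : 1 ≤ q) (hsb : F.SepBound p q c s s') (ξ : Set (Sym2 V)) :
    c * (rcMeasure G p q ∅).real
        {ω | ω ∩ (↑((F.edgesTouching (F.annSet s s')).filter fun e => ¬ e.IsDiag) :
          Set (Sym2 V))ᶜ = ξ} ≤
      (rcMeasure G p q ∅).real
        ({ω | ω ∩ (↑((F.edgesTouching (F.annSet s s')).filter fun e => ¬ e.IsDiag) :
            Set (Sym2 V)) ∈ F.sepEvent s s'} ∩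
          {ω | ω ∩ (↑((F.edgesTouching (F.annSet s s')).filter fun e => ¬ e.IsDiag) :
            Set (Sym2 V))ᶜ = ξ}) := by
  classical
  have hq0 : 0 < q := one_pos.trans_le hq
  haveI := isProbabilityMeasure_rcMeasure G hp hq0 ∅
  have hmeas : ∀ A : Set (BondConfig V), MeasurableSet A := fun A =>
    (Set.to_countable A).measurableSet
  set U : Finset (Sym2 V) := (F.edgesTouching (F.annSet s s')).filter fun e => ¬ e.IsDiag
    with hU
  set cyl : Set (BondConfig V) := {ω | ω ∩ (↑U : Set (Sym2 V))ᶜ = ξ} with hcyl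
  set Sev : Set (BondConfig V) := {ω | ω ∩ (↑U : Set (Sym2 V)) ∈ F.sepEvent s s'} with hSev
  have hUG : U ⊆ G.edgeFinset := fun e he => by
    obtain ⟨he1, he2⟩ := Finset.mem_filter.1 he
    rw [mem_edgeFinset, hG, edgeSet_fromEdgeSet]
    exact ⟨Finset.mem_coe.2 (F.mem_edgesTouching.1 he1).1, he2⟩
  have hD : IsLowerSet (F.sepEvent s s')ᶜ := (F.isUpperSet_sepEvent s s').compl
  have key := rcMeasure_real_inter_cylinder_le_mul_fromEdgeSet_of_isLowerSet G hp hq ∅ U hUG ξ hD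
  have hloc : (rcMeasure (fromEdgeSet (↑U : Set (Sym2 V))) p q ∅).real (F.sepEvent s s')ᶜ ≤
      1 - c := by
    rw [rcMeasure_congr_graph (fromEdgeSet_coe_filter_not_isDiag (F.edgesTouching (F.annSet s s')))
      p q ∅]
    haveI := isProbabilityMeasure_rcMeasure
      (fromEdgeSet (↑(F.edgesTouching (F.annSet s s')) : Set (Sym2 V))) hp hq0 ∅
    rw [measureReal_compl (hmeas _), probReal_univ]
    have h : c ≤ _ := hsb
    linarith
  have h1 : (rcMeasure G p q ∅).real (Sevᶜ ∩ cyl) ≤ (rcMeasure G p q ∅).real cyl * (1 - c) :=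
    key.trans (mul_le_mul_of_nonneg_left hloc measureReal_nonneg)
  have h2 : (rcMeasure G p q ∅).real (Sev ∩ cyl) + (rcMeasure G p q ∅).real (Sevᶜ ∩ cyl) =
      (rcMeasure G p q ∅).real cyl := by
    rw [Set.inter_comm Sev, Set.inter_comm Sevᶜ]
    exact measureReal_inter_add_sdiff (hmeas _)
  linarith

/-- **(J) The junk of one level of Kesten's chain is small.** For the block `(b, bM^m)` explored
from `inSet b` (`M ≥ 4`, `η ≤ b`, `bM^{m+1} ≤ Rmax`, separator bounds `SepBound p q c` for the
sub-annuli `(bM^i, bM^{i+1})`, `i + 1 ≤ m`, `c ≤ 1`, `q ≥ 1`), any increasing event `A` and any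
context event `Fo` determined by the frame edges all of whose good endpoints have radius
`≥ bM^m + η`: `φ(A ∩ Fo ∩ {rim not wired off inSet b}) ≤ (1 - c)^{⌊m/2⌋} φ(A ∩ Fo)` for the free
random-cluster measure `φ` of any graph `G` equal to the frame graph (instance-robust form) — a junk
configuration has no open separator in any of the `⌊m/2⌋` odd sub-annuli
(`rimWiredOff_of_sepEvent`), each of which costs a conditional factor `1 - c`
(`sepBound_cylinder`, `rcMeasure_real_inter_inter_biInter_compl_le`).
[cite: Kesten1986, proof of Thm. 3] -/
theorem ScaleFrame.inter_notWiredOff_le (F : ScaleFrame V) (G : SimpleGraph V)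
    [DecidableRel G.Adj] (hG : G = fromEdgeSet (↑F.E : Set (Sym2 V))) {p q c b M : ℝ} {m : ℕ}
    (hp : p ∈ Set.Icc (0 : ℝ) 1) (hq : 1 ≤ q) (hc1 : c ≤ 1) (hb : 0 < b) (hM : 4 ≤ M)
    (hRmax : b * M ^ (m + 1) ≤ F.Rmax) (hη : F.η ≤ b)
    (hsep : ∀ i : ℕ, i + 1 ≤ m → F.SepBound p q c (b * M ^ i) (b * M ^ (i + 1)))
    {A Fo : Set (BondConfig V)} (hA : IsUpperSet A)
    (hFo : ∀ ω₁ ω₂ : BondConfig V,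
      (∀ e ∈ F.E, (∀ x ∈ e, x ∈ F.good → b * M ^ m + F.η ≤ F.rad x) → (e ∈ ω₁ ↔ e ∈ ω₂)) →
        (ω₁ ∈ Fo ↔ ω₂ ∈ Fo)) :
    (rcMeasure G p q ∅).real (A ∩ Fo ∩
        {ω | ¬ ∀ r ∈ explRim (F.inSet b) (F.annSet b (b * M ^ m)) (ω ∩ (↑F.E : Set (Sym2 V))),
          ∀ r₂ ∈ explRim (F.inSet b) (F.annSet b (b * M ^ m)) (ω ∩ (↑F.E : Set (Sym2 V))),
            ∃ v ∈ explSet (F.inSet b) (F.annSet b (b * M ^ m)) (ω ∩ (↑F.E : Set (Sym2 V))) \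
                F.inSet b,
              ∃ v' ∈ explSet (F.inSet b) (F.annSet b (b * M ^ m)) (ω ∩ (↑F.E : Set (Sym2 V))) \
                  F.inSet b,
                s(v, r) ∈ ω ∩ (↑F.E : Set (Sym2 V)) ∧ s(v', r₂) ∈ ω ∩ (↑F.E : Set (Sym2 V)) ∧
                  ω ∩ (↑F.E : Set (Sym2 V)) ∈ openConnIn
                    (explSet (F.inSet b) (F.annSet b (b * M ^ m)) (ω ∩ (↑F.E : Set (Sym2 V))) \
                      F.inSet b) v v'}) ≤
      (1 - c) ^ (m / 2) * (rcMeasure G p q ∅).real (A ∩ Fo) := by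
  classical
  have hq0 : 0 < q := one_pos.trans_le hq
  haveI := isProbabilityMeasure_rcMeasure G hp hq0 ∅
  have hη0 := F.η_pos
  have hmR : b * M ^ m + b ≤ F.Rmax := (scale_gap hb hM (Nat.lt_succ_self m)).trans hRmax
  -- the odd sub-annuli, their genuine touching edges and their separator events
  set U : ℕ → Finset (Sym2 V) := fun j =>
    (F.edgesTouching (F.annSet (b * M ^ (2 * j + 1)) (b * M ^ (2 * j + 1 + 1)))).filter
      fun e => ¬ e.IsDiag with hU
  set S : ℕ → Set (BondConfig V) := fun j =>
    {ω | ω ∩ (↑(U j) : Set (Sym2 V)) ∈ F.sepEvent (b * M ^ (2 * j + 1)) (b * M ^ (2 * j + 1 + 1))}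
    with hS
  set sJ : Finset ℕ := Finset.range (m / 2) with hsJ
  have hjm : ∀ j ∈ sJ, 2 * j + 1 + 1 ≤ m := fun j hj => by
    have := Finset.mem_range.1 hj
    omega
  have hUmem : ∀ (j : ℕ) (e : Sym2 V), e ∈ U j ↔
      (e ∈ F.E ∧ ∃ v ∈ e, v ∈ F.annSet (b * M ^ (2 * j + 1)) (b * M ^ (2 * j + 1 + 1))) ∧
        ¬ e.IsDiag := fun j e => by
    simp only [hU, Finset.mem_filter, F.mem_edgesTouching]
  -- (1) the touching edge sets of distinct odd sub-annuli are disjoint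
  have hdisj : (↑sJ : Set ℕ).Pairwise fun j j' => Disjoint (U j) (U j') := by
    have aux : ∀ j j' : ℕ, j < j' → 2 * j' + 1 + 1 ≤ m → Disjoint (U j) (U j') := by
      intro j j' hjj' hj'm
      rw [Finset.disjoint_left]
      intro e he he'
      obtain ⟨⟨heE, v, hv, hvg, -, hv2⟩, -⟩ := (hUmem j e).1 he
      obtain ⟨⟨-, x, hx, -, hx1, -⟩, -⟩ := (hUmem j' e).1 he'
      have h1 : b * M ^ (2 * j + 1 + 1) + b ≤ b * M ^ (2 * j' + 1) := scale_gap hb hM (by omega)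
      have h2 : b * M ^ (2 * j' + 1) ≤ b * M ^ m := scale_mono hb hM (by omega)
      obtain ⟨-, hxr⟩ := F.adj_good e heE v hv x hx hvg (by linarith)
      have := (abs_lt.1 hxr).2
      linarith
    intro j hj j' hj' hne
    rcases lt_or_gt_of_ne hne with h | h
    · exact aux j j' h (hjm j' hj')
    · exact (aux j' j h (hjm j hj)).symm
  -- (2) the separator events are increasing and read on their own edges
  have hSup : ∀ j ∈ sJ, IsUpperSet (S j) := fun j _ ω₁ ω₂ hle h =>
    F.isUpperSet_sepEvent _ _ (Set.inter_subset_inter_left _ hle) h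
  have hSdet : ∀ j ∈ sJ, ∀ ω₁ ω₂ : BondConfig V, ω₁ ∩ ↑(U j) = ω₂ ∩ ↑(U j) →
      (ω₁ ∈ S j ↔ ω₂ ∈ S j) := by
    intro j _ ω₁ ω₂ h
    simp only [hS, Set.mem_setOf_eq, h]
  -- (3) the conditional separator bounds
  have hc : ∀ j ∈ sJ, ∀ ξ : Finset (Sym2 V), ξ ⊆ G.edgeFinset \ U j →
      c * (rcMeasure G p q ∅).real {ω | ω ∩ (↑(U j) : Set (Sym2 V))ᶜ = ↑ξ} ≤
        (rcMeasure G p q ∅).real (S j ∩ {ω | ω ∩ (↑(U j) : Set (Sym2 V))ᶜ = ↑ξ}) :=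
    fun j hj ξ _ => F.sepBound_cylinder G hG hp hq (hsep _ (hjm j hj)) ↑ξ
  -- (4) the context event is read off every `U j` (its edges lie far above the block)
  have hF : ∀ j ∈ sJ, ∀ ω₁ ω₂ : BondConfig V,
      ω₁ ∩ (↑(U j) : Set (Sym2 V))ᶜ = ω₂ ∩ (↑(U j) : Set (Sym2 V))ᶜ → (ω₁ ∈ Fo ↔ ω₂ ∈ Fo) := by
    intro j hj ω₁ ω₂ h
    refine hFo ω₁ ω₂ fun e _ hfar => ?_
    have heU : e ∈ (↑(U j) : Set (Sym2 V))ᶜ := fun heU => by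
      obtain ⟨⟨-, v, hv, hvg, -, hv2⟩, -⟩ := (hUmem j e).1 (Finset.mem_coe.1 heU)
      have h3 := hfar v hv hvg
      have h4 : b * M ^ (2 * j + 1 + 1) ≤ b * M ^ m := scale_mono hb hM (hjm j hj)
      linarith
    rw [Set.ext_iff] at h
    exact ⟨fun h1 => ((h e).1 ⟨h1, heU⟩).1, fun h2 => ((h e).2 ⟨h2, heU⟩).1⟩
  -- (5) successive conditioning
  have W3 := rcMeasure_real_inter_inter_biInter_compl_le G hp hq ∅ sJ U hdisj S hSup hSdet
    (fun _ => c) (fun _ _ => hc1) hc hA hF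
  rw [Finset.prod_const, hsJ, Finset.card_range] at W3
  refine le_trans ?_ W3
  -- (6) a junk configuration has no open separator in any sub-annulus
  refine rcMeasure_real_mono_of_forall_subset_edgeSet G hp hq0 ∅ fun ω hω hmem => ?_
  obtain ⟨hAF, hNW⟩ := hmem
  refine ⟨hAF, Set.mem_iInter₂.2 fun j hj hSj => hNW ?_⟩
  have hωG : ω ⊆ (fromEdgeSet (↑F.E : Set (Sym2 V))).edgeSet := hG ▸ hω
  have hωeq : ω ∩ (↑F.E : Set (Sym2 V)) = ω := inter_coe_eq_self_of_subset_edgeSet hωG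
  rw [hωeq]
  have hsepω : ω ∈ F.sepEvent (b * M ^ (2 * j + 1)) (b * M ^ (2 * j + 1 + 1)) :=
    F.isUpperSet_sepEvent _ _ (Set.inter_subset_left : ω ∩ ↑(U j) ⊆ ω) hSj
  exact F.rimWiredOff_of_sepEvent hb hM (hjm j hj) hη (by linarith) hωG hsepω

end Literature.Probability.LatticeModels
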